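import Summits.ValiantsHypothesis.ValiantsHypothesis.Theses.SymmetroidDescartes

/-!
# ValiantsHypothesis / SymmetroidDescartes — `Assembly`

Route `SymmetroidDescartes`, item `stmt-ValiantsHypothesis-18504` (assembly, rank 1):
`DerivedPencilRolle → RolleToDescartes → ThetaPencilWitness → ValiantsHypothesis`.

This is, verbatim, the type of the route's deciding theorem `closes`: the matrix Descartes rule
`LacunaryDescartes` is derived inside `closes` from the inductive step `DerivedPencilRolle` and
the glue `RolleToDescartes`, and the theta-pencil witness `ThetaPencilWitness` decides
`VP_ℂ ≠ VNP_ℂ` by inversion through `perNotPComputableComplex_iff_holds`. The proof is therefore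
the deciding theorem itself.
-/

-- `Summit.ValiantsHypothesis.ValiantsHypothesis.…` is the tree's mandated single-conjunct layout
-- (Sub = Summit), so the duplicated namespace component is intended.
set_option linter.dupNamespace false

namespace Summit.ValiantsHypothesis.ValiantsHypothesis.Theorems.SymmetroidDescartes

/-- Settles `stmt-ValiantsHypothesis-18504` (`Assembly`, route `SymmetroidDescartes`):
the inductive step `DerivedPencilRolle`, the glue `RolleToDescartes` and the theta-pencil witness
`ThetaPencilWitness` together give `VP_ℂ ≠ VNP_ℂ` — exactly the route's deciding theorem
`Summit.ValiantsHypothesis.ValiantsHypothesis.Theses.SymmetroidDescartes.closes`. [folklore] -/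
theorem assembly_proof :
    Summit.ValiantsHypothesis.ValiantsHypothesis.Theses.SymmetroidDescartes.Assembly := by
  unfold Summit.ValiantsHypothesis.ValiantsHypothesis.Theses.SymmetroidDescartes.Assembly
  intro h₁ h₂ h₃
  exact Summit.ValiantsHypothesis.ValiantsHypothesis.Theses.SymmetroidDescartes.closes h₁ h₂ h₃

end Summit.ValiantsHypothesis.ValiantsHypothesis.Theorems.SymmetroidDescartes
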